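import Summits.CriticalPhenomena.PercolationContinuityZ3.Theorems.PercNearOneGluingNoHeavyLowerTailCILOvertakingCells
import Summits.CriticalPhenomena.PercolationContinuityZ3.Theorems.PercNearOneGluingNoHeavyLowerTailCILSeparatedAsClosure
import Summits.CriticalPhenomena.PercolationContinuityZ3.Theorems.PercNearOneGluingNoHeavyLowerTailCILGlueBridge
import Summits.CriticalPhenomena.PercolationContinuityZ3.Theorems.PercNearOneGluingNoHeavyLowerTailQuantitativeObserverSet
import HarnessLib

/-!
# `NoHeavyLowerTail` (stmt-CriticalPhenomena-4575) — the QUANTITATIVE observer-set cell inequality in closure form, and the MEDIAN cell bound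

Support file (prover `prim-hp-3`, hull-port line; `--supports stmt-CriticalPhenomena-4575`).  No definitions, no named facts, no sorries.
Companion of `…CILOvertakingCells` (`Hyperedge.overtaking_cell` = the glued-pair margin bound of a two-block cell, closure form).  Same setting:
weight `K`, relays `A`, level `j`, nonempty blocks `T, S` with roots `rT ∈ T`, `rS ∈ S`, `rT ≠ rS`, here with `rT, rS ∈ A`; `R₂ = (Reach^T)^S`,
`R₁ = Reach^{T ∪ S}`; `c₂(v) = μ_K{|{z : R₂ v z}| ≤ j}`, `c₁(v) = μ_K{|{z : R₁ v z}| ≤ j}`; the cell value is `f = c₁(i) − c₁(rT)` and `d_T = c₂(i) − c₂(rT)`,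
`d_S = c₂(i) − c₂(rS)`.

* `Hyperedge.quantitative_cell` — **`min 0 (max d_T d_S) ≤ f`**: `HullPort.setCS_deficit_le_excess` (p191027, quantitative observerSet_le_of_lonelier, for
  the better of the two roots) read through `Hyperedge.sepMargin_eq_closure_sub` and the glue bridges (`real_twoBlock_reachFunctional`,
  `real_mergedBlock_reachFunctional`, `real_update_one_reachFunctional`).
* `Hyperedge.median_cell` — **`max (min d_T d_S) (min 0 (max d_T d_S)) ≤ f`**, i.e. `f ≥ median(d_T, d_S, 0)` (with `overtaking_cell`).
  This is the two-block cell of the reference-free CELL CRITERION of the crux notes (HULLPORT-REF-gen3.md §5, §10): with one-block cells exact, the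
  resulting lower bound `F_L ≤ F` for the two-sided kernel certifies 2 256 929 of the 2 256 935 TPS pairs of ttrl2's complete designs (the 6 others have
  a shared port and are certified by `observerSet_le_of_lonelier` / the one-group criterion) and every sampled three-star pair.
-/

noncomputable section

namespace Summit.CriticalPhenomena.PercolationContinuityZ3.Theorems

open MeasureTheory Set Literature.Probability.LatticeModels Literature.Probability.Percolation
open scoped Classical BigOperators

variable {n : ℕ}

namespace Hyperedge

/-- **Quantitative observer-set cell inequality (closure form).**  For nonempty blocks with roots `rT ∈ T`, `rS ∈ S` (`rT ≠ rS`, both relays)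
and any vertex `i`: `min 0 (max (c₂(i) − c₂(rT)) (c₂(i) − c₂(rS))) ≤ c₁(i) − c₁(rT)`. [cite: VandenbergHaggstromKahn2005, Thm. 1.5 (p. 7) — via
`HullPort.setCS_deficit_le_excess`; this work] -/
theorem quantitative_cell (K : Sym2 (Fin n) → unitInterval) (A T S : Finset (Fin n)) {rT rS : Fin n}
    (hrT : rT ∈ T) (hrS : rS ∈ S) (hne : rT ≠ rS) (hrTA : rT ∈ A) (hrSA : rS ∈ A) (i : Fin n) (j : ℕ) :
    min 0 (max ((prodBernoulli K).real {ω : BondConfig (Fin n) | (A.filter fun z =>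
          ((openGraph ω).Reachable i z ∨ ((∃ t ∈ T, (openGraph ω).Reachable i t) ∧ ∃ t ∈ T, (openGraph ω).Reachable t z)) ∨
            ((∃ s ∈ S, (openGraph ω).Reachable i s ∨ ((∃ t ∈ T, (openGraph ω).Reachable i t) ∧ ∃ t ∈ T, (openGraph ω).Reachable t s)) ∧
              ∃ s ∈ S, (openGraph ω).Reachable s z ∨ ((∃ t ∈ T, (openGraph ω).Reachable s t) ∧ ∃ t ∈ T, (openGraph ω).Reachable t z))).card ≤ j} -
        (prodBernoulli K).real {ω : BondConfig (Fin n) | (A.filter fun z =>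
          ((openGraph ω).Reachable rT z ∨ ((∃ t ∈ T, (openGraph ω).Reachable rT t) ∧ ∃ t ∈ T, (openGraph ω).Reachable t z)) ∨
            ((∃ s ∈ S, (openGraph ω).Reachable rT s ∨ ((∃ t ∈ T, (openGraph ω).Reachable rT t) ∧ ∃ t ∈ T, (openGraph ω).Reachable t s)) ∧
              ∃ s ∈ S, (openGraph ω).Reachable s z ∨ ((∃ t ∈ T, (openGraph ω).Reachable s t) ∧ ∃ t ∈ T, (openGraph ω).Reachable t z))).card ≤ j})
        ((prodBernoulli K).real {ω : BondConfig (Fin n) | (A.filter fun z =>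
          ((openGraph ω).Reachable i z ∨ ((∃ t ∈ T, (openGraph ω).Reachable i t) ∧ ∃ t ∈ T, (openGraph ω).Reachable t z)) ∨
            ((∃ s ∈ S, (openGraph ω).Reachable i s ∨ ((∃ t ∈ T, (openGraph ω).Reachable i t) ∧ ∃ t ∈ T, (openGraph ω).Reachable t s)) ∧
              ∃ s ∈ S, (openGraph ω).Reachable s z ∨ ((∃ t ∈ T, (openGraph ω).Reachable s t) ∧ ∃ t ∈ T, (openGraph ω).Reachable t z))).card ≤ j} -
        (prodBernoulli K).real {ω : BondConfig (Fin n) | (A.filter fun z =>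
          ((openGraph ω).Reachable rS z ∨ ((∃ t ∈ T, (openGraph ω).Reachable rS t) ∧ ∃ t ∈ T, (openGraph ω).Reachable t z)) ∨
            ((∃ s ∈ S, (openGraph ω).Reachable rS s ∨ ((∃ t ∈ T, (openGraph ω).Reachable rS t) ∧ ∃ t ∈ T, (openGraph ω).Reachable t s)) ∧
              ∃ s ∈ S, (openGraph ω).Reachable s z ∨ ((∃ t ∈ T, (openGraph ω).Reachable s t) ∧ ∃ t ∈ T, (openGraph ω).Reachable t z))).card ≤ j})) ≤
      (prodBernoulli K).real {ω : BondConfig (Fin n) | (A.filter fun z => (openGraph ω).Reachable i z ∨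
          ((∃ t ∈ T ∪ S, (openGraph ω).Reachable i t) ∧ ∃ t ∈ T ∪ S, (openGraph ω).Reachable t z)).card ≤ j} -
        (prodBernoulli K).real {ω : BondConfig (Fin n) | (A.filter fun z => (openGraph ω).Reachable rT z ∨
          ((∃ t ∈ T ∪ S, (openGraph ω).Reachable rT t) ∧ ∃ t ∈ T ∪ S, (openGraph ω).Reachable t z)).card ≤ j} := by
  set W := (S.erase rS).toList.foldr (fun s w' => Function.update w' s(rS, s) 1)
    ((T.erase rT).toList.foldr (fun t w' => Function.update w' s(rT, t) 1) K) with hW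
  have two := fun v : Fin n => real_twoBlock_reachFunctional K T S hrT hrS (fun R => (A.filter fun z => R v z).card ≤ j)
  have one := fun v : Fin n => real_mergedBlock_reachFunctional K T S hrT hrS hne (fun R => (A.filter fun z => R v z).card ≤ j)
  have h2i := two i; have h2T := two rT; have h2S := two rS; have h1i := one i; have h1T := one rT
  beta_reduce at h2i h2T h2S h1i h1T
  rw [← hW] at h2i h2T h2S h1i h1T
  have a1 : (prodBernoulli K).real {ω : BondConfig (Fin n) | (A.filter fun z =>
          ((openGraph ω).Reachable i z ∨ ((∃ t ∈ T, (openGraph ω).Reachable i t) ∧ ∃ t ∈ T, (openGraph ω).Reachable t z)) ∨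
            ((∃ s ∈ S, (openGraph ω).Reachable i s ∨ ((∃ t ∈ T, (openGraph ω).Reachable i t) ∧ ∃ t ∈ T, (openGraph ω).Reachable t s)) ∧
              ∃ s ∈ S, (openGraph ω).Reachable s z ∨ ((∃ t ∈ T, (openGraph ω).Reachable s t) ∧ ∃ t ∈ T, (openGraph ω).Reachable t z))).card ≤ j} =
      (prodBernoulli W).real {ω : BondConfig (Fin n) | (A.filter fun x => ω ∈ openConn i x).card ≤ j} := by
    convert h2i.symm using 3
    rfl
  have a2 : (prodBernoulli K).real {ω : BondConfig (Fin n) | (A.filter fun z =>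
          ((openGraph ω).Reachable rT z ∨ ((∃ t ∈ T, (openGraph ω).Reachable rT t) ∧ ∃ t ∈ T, (openGraph ω).Reachable t z)) ∨
            ((∃ s ∈ S, (openGraph ω).Reachable rT s ∨ ((∃ t ∈ T, (openGraph ω).Reachable rT t) ∧ ∃ t ∈ T, (openGraph ω).Reachable t s)) ∧
              ∃ s ∈ S, (openGraph ω).Reachable s z ∨ ((∃ t ∈ T, (openGraph ω).Reachable s t) ∧ ∃ t ∈ T, (openGraph ω).Reachable t z))).card ≤ j} =
      (prodBernoulli W).real {ω : BondConfig (Fin n) | (A.filter fun x => ω ∈ openConn rT x).card ≤ j} := by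
    convert h2T.symm using 3
    rfl
  have a3 : (prodBernoulli K).real {ω : BondConfig (Fin n) | (A.filter fun z =>
          ((openGraph ω).Reachable rS z ∨ ((∃ t ∈ T, (openGraph ω).Reachable rS t) ∧ ∃ t ∈ T, (openGraph ω).Reachable t z)) ∨
            ((∃ s ∈ S, (openGraph ω).Reachable rS s ∨ ((∃ t ∈ T, (openGraph ω).Reachable rS t) ∧ ∃ t ∈ T, (openGraph ω).Reachable t s)) ∧
              ∃ s ∈ S, (openGraph ω).Reachable s z ∨ ((∃ t ∈ T, (openGraph ω).Reachable s t) ∧ ∃ t ∈ T, (openGraph ω).Reachable t z))).card ≤ j} =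
      (prodBernoulli W).real {ω : BondConfig (Fin n) | (A.filter fun x => ω ∈ openConn rS x).card ≤ j} := by
    convert h2S.symm using 3
    rfl
  have b1 : (prodBernoulli K).real {ω : BondConfig (Fin n) | (A.filter fun z => (openGraph ω).Reachable i z ∨
          ((∃ t ∈ T ∪ S, (openGraph ω).Reachable i t) ∧ ∃ t ∈ T ∪ S, (openGraph ω).Reachable t z)).card ≤ j} =
      (prodBernoulli (Function.update W s(rT, rS) 1)).real
        {ω : BondConfig (Fin n) | (A.filter fun x => ω ∈ openConn i x).card ≤ j} := by
    convert h1i.symm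
    exact Iff.rfl
  have b2 : (prodBernoulli K).real {ω : BondConfig (Fin n) | (A.filter fun z => (openGraph ω).Reachable rT z ∨
          ((∃ t ∈ T ∪ S, (openGraph ω).Reachable rT t) ∧ ∃ t ∈ T ∪ S, (openGraph ω).Reachable t z)).card ≤ j} =
      (prodBernoulli (Function.update W s(rT, rS) 1)).real
        {ω : BondConfig (Fin n) | (A.filter fun x => ω ∈ openConn rT x).card ≤ j} := by
    convert h1T.symm
    exact Iff.rfl
  rw [a1, a2, a3, b1, b2]
  -- now an honest statement about `W` and `W[s(rT,rS) ↦ 1]`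
  set B : Finset (Fin n) := {rT, rS} with hB
  have hBA : B ⊆ A := by
    intro v hv; rw [hB, Finset.mem_insert, Finset.mem_singleton] at hv
    rcases hv with rfl | rfl <;> assumption
  have hBne : B.Nonempty := ⟨rT, by simp [hB]⟩
  have hrTB : rT ∈ B := by simp [hB]
  have hrSB : rS ∈ B := by simp [hB]
  -- quantitative observer-set transfer for both roots (separated form, in `W`)
  have hqT : (prodBernoulli W).real {ω : BondConfig (Fin n) | (∀ x ∈ B, ω ∉ openConn i x) ∧ 1 ≤ (A.filter fun z => ∃ x ∈ B, ω ∈ openConn x z).card ∧ (A.filter fun z => ∃ x ∈ B, ω ∈ openConn x z).card ≤ j} ≤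
      (prodBernoulli W).real {ω : BondConfig (Fin n) | (∀ x ∈ B, ω ∉ openConn i x) ∧ (A.filter fun z => ω ∈ openConn i z).card ≤ j} + max 0 ((prodBernoulli W).real {ω : BondConfig (Fin n) | (A.filter fun x => ω ∈ openConn rT x).card ≤ j} - (prodBernoulli W).real {ω : BondConfig (Fin n) | (A.filter fun x => ω ∈ openConn i x).card ≤ j}) := by
    convert HullPort.setCS_deficit_le_excess W A B rT i hrTB j using 12
  have hqS : (prodBernoulli W).real {ω : BondConfig (Fin n) | (∀ x ∈ B, ω ∉ openConn i x) ∧ 1 ≤ (A.filter fun z => ∃ x ∈ B, ω ∈ openConn x z).card ∧ (A.filter fun z => ∃ x ∈ B, ω ∈ openConn x z).card ≤ j} ≤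
      (prodBernoulli W).real {ω : BondConfig (Fin n) | (∀ x ∈ B, ω ∉ openConn i x) ∧ (A.filter fun z => ω ∈ openConn i z).card ≤ j} + max 0 ((prodBernoulli W).real {ω : BondConfig (Fin n) | (A.filter fun x => ω ∈ openConn rS x).card ≤ j} - (prodBernoulli W).real {ω : BondConfig (Fin n) | (A.filter fun x => ω ∈ openConn i x).card ≤ j}) := by
    convert HullPort.setCS_deficit_le_excess W A B rS i hrSB j using 12
  -- separated margin = closure difference (in `W`)
  have hsep : (prodBernoulli W).real {ω : BondConfig (Fin n) | (∀ x ∈ B, ω ∉ openConn i x) ∧ (A.filter fun z => ω ∈ openConn i z).card ≤ j} -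
      (prodBernoulli W).real {ω : BondConfig (Fin n) | (∀ x ∈ B, ω ∉ openConn i x) ∧ 1 ≤ (A.filter fun z => ∃ x ∈ B, ω ∈ openConn x z).card ∧ (A.filter fun z => ∃ x ∈ B, ω ∈ openConn x z).card ≤ j} =
      (prodBernoulli W).real {ω : BondConfig (Fin n) | (A.filter fun z => (openGraph ω).Reachable i z ∨ ((∃ t ∈ B, (openGraph ω).Reachable i t) ∧ ∃ t ∈ B, (openGraph ω).Reachable t z)).card ≤ j} -
      (prodBernoulli W).real {ω : BondConfig (Fin n) | (A.filter fun z => ∃ s ∈ B, ((openGraph ω).Reachable s z ∨ ((∃ t ∈ B, (openGraph ω).Reachable s t) ∧ ∃ t ∈ B, (openGraph ω).Reachable t z))).card ≤ j} := by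
    convert sepMargin_eq_closure_sub W A B i j hBA hBne using 12 <;> rfl
  -- glue bridges: closure lightness in `W` = honest lightness in `W[s(rT,rS) ↦ 1]`
  have hb1 := real_update_one_reachFunctional W hne (fun R => (A.filter fun z => R i z).card ≤ j)
  have hb2 := real_update_one_reachFunctional W hne (fun R => (A.filter fun z => R rT z).card ≤ j)
  beta_reduce at hb1 hb2
  rw [← hB] at hb1 hb2
  have hbi : (prodBernoulli (Function.update W s(rT, rS) 1)).real {ω : BondConfig (Fin n) | (A.filter fun x => ω ∈ openConn i x).card ≤ j} =
      (prodBernoulli W).real {ω : BondConfig (Fin n) | (A.filter fun z => (openGraph ω).Reachable i z ∨ ((∃ t ∈ B, (openGraph ω).Reachable i t) ∧ ∃ t ∈ B, (openGraph ω).Reachable t z)).card ≤ j} := by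
    convert hb1 using 12; rfl
  have hbT : (prodBernoulli (Function.update W s(rT, rS) 1)).real {ω : BondConfig (Fin n) | (A.filter fun x => ω ∈ openConn rT x).card ≤ j} =
      (prodBernoulli W).real {ω : BondConfig (Fin n) | (A.filter fun z => (openGraph ω).Reachable rT z ∨ ((∃ t ∈ B, (openGraph ω).Reachable rT t) ∧ ∃ t ∈ B, (openGraph ω).Reachable t z)).card ≤ j} := by
    convert hb2 using 12; rfl
  -- the block event: `∃ s ∈ B, closure s z` ↔ `closure rT z` (as `rT ∈ B`)
  have hblk : (prodBernoulli W).real {ω : BondConfig (Fin n) | (A.filter fun z => ∃ s ∈ B, ((openGraph ω).Reachable s z ∨ ((∃ t ∈ B, (openGraph ω).Reachable s t) ∧ ∃ t ∈ B, (openGraph ω).Reachable t z))).card ≤ j} =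
      (prodBernoulli W).real {ω : BondConfig (Fin n) | (A.filter fun z => (openGraph ω).Reachable rT z ∨ ((∃ t ∈ B, (openGraph ω).Reachable rT t) ∧ ∃ t ∈ B, (openGraph ω).Reachable t z)).card ≤ j} := by
    congr 1; ext ω; simp only [mem_setOf_eq]
    have hfc : (A.filter fun z => ∃ s ∈ B, ((openGraph ω).Reachable s z ∨
          ((∃ t ∈ B, (openGraph ω).Reachable s t) ∧ ∃ t ∈ B, (openGraph ω).Reachable t z))) =
        (A.filter fun z => (openGraph ω).Reachable rT z ∨
          ((∃ t ∈ B, (openGraph ω).Reachable rT t) ∧ ∃ t ∈ B, (openGraph ω).Reachable t z)) := by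
      refine Finset.filter_congr fun z _ => ?_
      constructor
      · rintro ⟨s, hs, hsz⟩
        rcases hsz with h | ⟨_, h⟩
        · exact Or.inr ⟨⟨rT, hrTB, SimpleGraph.Reachable.refl rT⟩, ⟨s, hs, h⟩⟩
        · exact Or.inr ⟨⟨rT, hrTB, SimpleGraph.Reachable.refl rT⟩, h⟩
      · intro h
        exact ⟨rT, hrTB, h⟩
    rw [hfc]
  -- real arithmetic
  have hCS : min 0 (max ((prodBernoulli W).real {ω : BondConfig (Fin n) | (A.filter fun x => ω ∈ openConn i x).card ≤ j} - (prodBernoulli W).real {ω : BondConfig (Fin n) | (A.filter fun x => ω ∈ openConn rT x).card ≤ j}) ((prodBernoulli W).real {ω : BondConfig (Fin n) | (A.filter fun x => ω ∈ openConn i x).card ≤ j} - (prodBernoulli W).real {ω : BondConfig (Fin n) | (A.filter fun x => ω ∈ openConn rS x).card ≤ j})) ≤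
      (prodBernoulli W).real {ω : BondConfig (Fin n) | (∀ x ∈ B, ω ∉ openConn i x) ∧ (A.filter fun z => ω ∈ openConn i z).card ≤ j} -
      (prodBernoulli W).real {ω : BondConfig (Fin n) | (∀ x ∈ B, ω ∉ openConn i x) ∧ 1 ≤ (A.filter fun z => ∃ x ∈ B, ω ∈ openConn x z).card ∧ (A.filter fun z => ∃ x ∈ B, ω ∈ openConn x z).card ≤ j} := by
    rcases le_total ((prodBernoulli W).real {ω : BondConfig (Fin n) | (A.filter fun x => ω ∈ openConn rT x).card ≤ j}) ((prodBernoulli W).real {ω : BondConfig (Fin n) | (A.filter fun x => ω ∈ openConn i x).card ≤ j}) with hT | hT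
    · rw [max_eq_left (by linarith)] at hqT
      have h0 : min 0 (max ((prodBernoulli W).real {ω : BondConfig (Fin n) | (A.filter fun x => ω ∈ openConn i x).card ≤ j} - (prodBernoulli W).real {ω : BondConfig (Fin n) | (A.filter fun x => ω ∈ openConn rT x).card ≤ j}) ((prodBernoulli W).real {ω : BondConfig (Fin n) | (A.filter fun x => ω ∈ openConn i x).card ≤ j} - (prodBernoulli W).real {ω : BondConfig (Fin n) | (A.filter fun x => ω ∈ openConn rS x).card ≤ j})) ≤ 0 := min_le_left _ _
      linarith
    rcases le_total ((prodBernoulli W).real {ω : BondConfig (Fin n) | (A.filter fun x => ω ∈ openConn rS x).card ≤ j}) ((prodBernoulli W).real {ω : BondConfig (Fin n) | (A.filter fun x => ω ∈ openConn i x).card ≤ j}) with hS | hS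
    · rw [max_eq_left (by linarith)] at hqS
      have h0 : min 0 (max ((prodBernoulli W).real {ω : BondConfig (Fin n) | (A.filter fun x => ω ∈ openConn i x).card ≤ j} - (prodBernoulli W).real {ω : BondConfig (Fin n) | (A.filter fun x => ω ∈ openConn rT x).card ≤ j}) ((prodBernoulli W).real {ω : BondConfig (Fin n) | (A.filter fun x => ω ∈ openConn i x).card ≤ j} - (prodBernoulli W).real {ω : BondConfig (Fin n) | (A.filter fun x => ω ∈ openConn rS x).card ≤ j})) ≤ 0 := min_le_left _ _
      linarith
    rw [max_eq_right (by linarith)] at hqT hqS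
    have hmin : min 0 (max ((prodBernoulli W).real {ω : BondConfig (Fin n) | (A.filter fun x => ω ∈ openConn i x).card ≤ j} - (prodBernoulli W).real {ω : BondConfig (Fin n) | (A.filter fun x => ω ∈ openConn rT x).card ≤ j}) ((prodBernoulli W).real {ω : BondConfig (Fin n) | (A.filter fun x => ω ∈ openConn i x).card ≤ j} - (prodBernoulli W).real {ω : BondConfig (Fin n) | (A.filter fun x => ω ∈ openConn rS x).card ≤ j})) ≤
        max ((prodBernoulli W).real {ω : BondConfig (Fin n) | (A.filter fun x => ω ∈ openConn i x).card ≤ j} - (prodBernoulli W).real {ω : BondConfig (Fin n) | (A.filter fun x => ω ∈ openConn rT x).card ≤ j}) ((prodBernoulli W).real {ω : BondConfig (Fin n) | (A.filter fun x => ω ∈ openConn i x).card ≤ j} - (prodBernoulli W).real {ω : BondConfig (Fin n) | (A.filter fun x => ω ∈ openConn rS x).card ≤ j}) := min_le_right _ _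
    rcases le_total ((prodBernoulli W).real {ω : BondConfig (Fin n) | (A.filter fun x => ω ∈ openConn rT x).card ≤ j}) ((prodBernoulli W).real {ω : BondConfig (Fin n) | (A.filter fun x => ω ∈ openConn rS x).card ≤ j}) with h1 | h1
    · rw [max_eq_left (by linarith)] at hmin ⊢
      linarith
    · rw [max_eq_right (by linarith)] at hmin ⊢
      linarith
  rw [hbi, hbT, ← hblk, ← hsep]
  exact hCS

/-- **The MEDIAN cell bound.**  Same setting: `max (min d_T d_S) (min 0 (max d_T d_S)) ≤ f`, i.e. the two-block cell value is at least the median of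
`d_T, d_S, 0` (`overtaking_cell` gives `min d_T d_S`, `quantitative_cell` gives `min 0 (max d_T d_S)`). [this work] -/
theorem median_cell (K : Sym2 (Fin n) → unitInterval) (A T S : Finset (Fin n)) {rT rS : Fin n}
    (hrT : rT ∈ T) (hrS : rS ∈ S) (hne : rT ≠ rS) (hrTA : rT ∈ A) (hrSA : rS ∈ A) (i : Fin n) (j : ℕ) :
    max (min ((prodBernoulli K).real {ω : BondConfig (Fin n) | (A.filter fun z =>
          ((openGraph ω).Reachable i z ∨ ((∃ t ∈ T, (openGraph ω).Reachable i t) ∧ ∃ t ∈ T, (openGraph ω).Reachable t z)) ∨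
            ((∃ s ∈ S, (openGraph ω).Reachable i s ∨ ((∃ t ∈ T, (openGraph ω).Reachable i t) ∧ ∃ t ∈ T, (openGraph ω).Reachable t s)) ∧
              ∃ s ∈ S, (openGraph ω).Reachable s z ∨ ((∃ t ∈ T, (openGraph ω).Reachable s t) ∧ ∃ t ∈ T, (openGraph ω).Reachable t z))).card ≤ j} -
        (prodBernoulli K).real {ω : BondConfig (Fin n) | (A.filter fun z =>
          ((openGraph ω).Reachable rT z ∨ ((∃ t ∈ T, (openGraph ω).Reachable rT t) ∧ ∃ t ∈ T, (openGraph ω).Reachable t z)) ∨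
            ((∃ s ∈ S, (openGraph ω).Reachable rT s ∨ ((∃ t ∈ T, (openGraph ω).Reachable rT t) ∧ ∃ t ∈ T, (openGraph ω).Reachable t s)) ∧
              ∃ s ∈ S, (openGraph ω).Reachable s z ∨ ((∃ t ∈ T, (openGraph ω).Reachable s t) ∧ ∃ t ∈ T, (openGraph ω).Reachable t z))).card ≤ j})
        ((prodBernoulli K).real {ω : BondConfig (Fin n) | (A.filter fun z =>
          ((openGraph ω).Reachable i z ∨ ((∃ t ∈ T, (openGraph ω).Reachable i t) ∧ ∃ t ∈ T, (openGraph ω).Reachable t z)) ∨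
            ((∃ s ∈ S, (openGraph ω).Reachable i s ∨ ((∃ t ∈ T, (openGraph ω).Reachable i t) ∧ ∃ t ∈ T, (openGraph ω).Reachable t s)) ∧
              ∃ s ∈ S, (openGraph ω).Reachable s z ∨ ((∃ t ∈ T, (openGraph ω).Reachable s t) ∧ ∃ t ∈ T, (openGraph ω).Reachable t z))).card ≤ j} -
        (prodBernoulli K).real {ω : BondConfig (Fin n) | (A.filter fun z =>
          ((openGraph ω).Reachable rS z ∨ ((∃ t ∈ T, (openGraph ω).Reachable rS t) ∧ ∃ t ∈ T, (openGraph ω).Reachable t z)) ∨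
            ((∃ s ∈ S, (openGraph ω).Reachable rS s ∨ ((∃ t ∈ T, (openGraph ω).Reachable rS t) ∧ ∃ t ∈ T, (openGraph ω).Reachable t s)) ∧
              ∃ s ∈ S, (openGraph ω).Reachable s z ∨ ((∃ t ∈ T, (openGraph ω).Reachable s t) ∧ ∃ t ∈ T, (openGraph ω).Reachable t z))).card ≤ j}))
      (min 0 (max ((prodBernoulli K).real {ω : BondConfig (Fin n) | (A.filter fun z =>
          ((openGraph ω).Reachable i z ∨ ((∃ t ∈ T, (openGraph ω).Reachable i t) ∧ ∃ t ∈ T, (openGraph ω).Reachable t z)) ∨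
            ((∃ s ∈ S, (openGraph ω).Reachable i s ∨ ((∃ t ∈ T, (openGraph ω).Reachable i t) ∧ ∃ t ∈ T, (openGraph ω).Reachable t s)) ∧
              ∃ s ∈ S, (openGraph ω).Reachable s z ∨ ((∃ t ∈ T, (openGraph ω).Reachable s t) ∧ ∃ t ∈ T, (openGraph ω).Reachable t z))).card ≤ j} -
        (prodBernoulli K).real {ω : BondConfig (Fin n) | (A.filter fun z =>
          ((openGraph ω).Reachable rT z ∨ ((∃ t ∈ T, (openGraph ω).Reachable rT t) ∧ ∃ t ∈ T, (openGraph ω).Reachable t z)) ∨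
            ((∃ s ∈ S, (openGraph ω).Reachable rT s ∨ ((∃ t ∈ T, (openGraph ω).Reachable rT t) ∧ ∃ t ∈ T, (openGraph ω).Reachable t s)) ∧
              ∃ s ∈ S, (openGraph ω).Reachable s z ∨ ((∃ t ∈ T, (openGraph ω).Reachable s t) ∧ ∃ t ∈ T, (openGraph ω).Reachable t z))).card ≤ j})
        ((prodBernoulli K).real {ω : BondConfig (Fin n) | (A.filter fun z =>
          ((openGraph ω).Reachable i z ∨ ((∃ t ∈ T, (openGraph ω).Reachable i t) ∧ ∃ t ∈ T, (openGraph ω).Reachable t z)) ∨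
            ((∃ s ∈ S, (openGraph ω).Reachable i s ∨ ((∃ t ∈ T, (openGraph ω).Reachable i t) ∧ ∃ t ∈ T, (openGraph ω).Reachable t s)) ∧
              ∃ s ∈ S, (openGraph ω).Reachable s z ∨ ((∃ t ∈ T, (openGraph ω).Reachable s t) ∧ ∃ t ∈ T, (openGraph ω).Reachable t z))).card ≤ j} -
        (prodBernoulli K).real {ω : BondConfig (Fin n) | (A.filter fun z =>
          ((openGraph ω).Reachable rS z ∨ ((∃ t ∈ T, (openGraph ω).Reachable rS t) ∧ ∃ t ∈ T, (openGraph ω).Reachable t z)) ∨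
            ((∃ s ∈ S, (openGraph ω).Reachable rS s ∨ ((∃ t ∈ T, (openGraph ω).Reachable rS t) ∧ ∃ t ∈ T, (openGraph ω).Reachable t s)) ∧
              ∃ s ∈ S, (openGraph ω).Reachable s z ∨ ((∃ t ∈ T, (openGraph ω).Reachable s t) ∧ ∃ t ∈ T, (openGraph ω).Reachable t z))).card ≤ j}))) ≤
      (prodBernoulli K).real {ω : BondConfig (Fin n) | (A.filter fun z => (openGraph ω).Reachable i z ∨
          ((∃ t ∈ T ∪ S, (openGraph ω).Reachable i t) ∧ ∃ t ∈ T ∪ S, (openGraph ω).Reachable t z)).card ≤ j} -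
        (prodBernoulli K).real {ω : BondConfig (Fin n) | (A.filter fun z => (openGraph ω).Reachable rT z ∨
          ((∃ t ∈ T ∪ S, (openGraph ω).Reachable rT t) ∧ ∃ t ∈ T ∪ S, (openGraph ω).Reachable t z)).card ≤ j} := by
  refine max_le ?_ (quantitative_cell K A T S hrT hrS hne hrTA hrSA i j)
  have h := overtaking_cell K A T S hrT hrS hne i j
  -- `min d_T d_S = c₂(i) − max(c₂ rT, c₂ rS)`
  rw [min_sub_sub_left]
  exact h

end Hyperedge

end Summit.CriticalPhenomena.PercolationContinuityZ3.Theorems
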